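import Literature.Probability.RandomPlanarGeometry.HexSAWStripBridgeSpanPointwise
import Literature.Probability.RandomPlanarGeometry.HexSAWStripThresholdLinearLower
import HarnessLib

/-!
# No escape through the sides at the threshold: `E_{T,L}(x_c; y_T) ≤ C_T` for every `L`, and the lock-step of the arches and
# bridges `cos(3π/8) A_{T,L}(x_c; y_T) + β(y_T) B_{T,L}(x_c; y_T) = 1 + O(1)`

Topic `Literature/Probability/RandomPlanarGeometry` (continues `HexSAWStripBridgeSpanPointwise.lean` — the SPAN-POINTWISE law
`HV.exists_hBridgesN_span_stripYT_le`: the horizontal bridges of exact span have bounded weight at `y_T`, uniformly in the span —,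
`HexSAWStripCurtain.lean` (`HV.curtain_lemma`), `HexSAWStripBridgeDecomposition.lean` / `HexSAWStripBridgeRenewal.lean` (`HV.sIdx`, `HV.IsHBridge`, `HV.hBridgesN`,
`HV.mirrorX`), `HexSAWStripThresholdLinearLower.lean` (`HV.LinLow.chainsUpTo`, `HV.LinLow.exists_sum_pow_length_le`: the strip chains
are summable at `y = 1`), and the strip identity `HV.stripIdentityY_holds`).  Sources: H. Duminil-Copin, S. Smirnov, Ann. Math. 175 (2012)
§3 (the domain `S_{T,L}`, its boundary parts `α, β, ε, ε̄`, the series `E_{T,L}`); N. R. Beaton, M. Bousquet-Mélou, J. de Gier, H. Duminil-Copin,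
A. J. Guttmann, CMP 326 (2014), arXiv:1109.0358v5, §3.3 (`E_{T,L}(x_c; y)`), §4.1 eq. (16) (p. 13: the identity
`cos(3π/8) A_{T,L} + cos(π/4) E_{T,L} + β(y) B_{T,L} = 1`), Corollary 8 (p. 12: `y_T`); H. Duminil-Copin, A. Hammond, CMP 324 (2013) §2.2
(bridges).  In print `E_T(x_c; y) = 0` for `y < y_T` is used (tree: `HexSAWStripELimZeroY`); nothing is printed about `E` AT `y_T`.

## What is proved (namespace `Literature.Probability.RandomPlanarGeometry.SAW.HV`; plumbing in `HV.EBnd`; `T ≥ 1`)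

* `EBnd.stair` — the rightward zig-zag outside the box (`isChain_stair`, `nodup_stair`, columns `ξ = 2x₀ + x₁ + i`).
* `EBnd.epsRightLists` / `EBnd.epsLeftLists` — the inner lists of the walks `a → ε` / `a → ε̄` of `S_{T,L}` (`eq_of_isEpsRight/Left`,
  `of_mem_…`, `mem_epsRightLists_of`); `EBnd.stripGFy_eps_eq_sum_right_add_left` (`E_{T,L} = Σ_right + Σ_left`);
  `EBnd.map_mirrorX_mem_epsRightLists`, `EBnd.sum_left_le_sum_right` (the mirror `HV.mirrorX`).
* `EBnd.extR` — a right-exit list extended by `T + 1` vertices of staircase (`isChain_extR`, `nodup_extR`, `inLev_extR`, `xiAt_extR`,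
  `sIdx_extR`: the last visit to the minimal column is in the box, every later column is larger, the LAST vertex has the strictly largest column).
* ★ `EBnd.lev_ne_top_of_lt_sIdx_extR` — THE CURTAIN ARGUMENT: before its last visit to the minimal column a side-exit walk has no top vertex.
* `EBnd.eH` / `EBnd.eB` — head (top-free except its last vertex, `eH_mem`) and bridge piece (a standard horizontal bridge whose span is
  `(2L + 2 + x₁ + T) − ξ_min`, `eB_mem`); `wt_le_eH_eB` (weights, cost `x_c^{−(T+1)}`), `eH_eB_injOn` (injective).
* ★★ `EBnd.exists_sum_epsRightLists_le` — `Σ_{right exits} x_c^{|l|} y_T^{#top(l)} ≤ C` uniformly in `L`.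
* ★★★ `exists_stripGFy_eps_stripYT_le` — `∃ C, ∀ L, E_{T,L}(x_c; y_T) ≤ C`.
* ★★★ `exists_abs_alpha_add_betaY_mul_beta_sub_one_le` — `∃ C, ∀ L, |cos(3π/8) A_{T,L}(x_c;y_T) + β(y_T) B_{T,L}(x_c;y_T) − 1| ≤ C`
  (`β(y_T) < 0`): LOCK-STEP of the two divergent classes; `exists_abs_alpha_sub_ratio_mul_beta_le` — `A_{T,L} = (−β(y_T)/cos(3π/8)) B_{T,L} + O(1)`
  (the tree's `HV.tendsto_div_stripGFy_beta_stripYT` is the ratio statement only).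

Route (lane «pcv-sawmu», a-p2 g17; automaton-free): extend a right-exit walk through its exit mid-edge by a staircase of `T` more steps
outside the box, so that the extended list ends strictly to the right (in `ξ`) of every vertex; cut it at the LAST visit `s` to its minimal
column: by the curtain lemma the part before `s` has no top vertex (else the passage `s → end`, from the minimal to beyond the maximal
column and disjoint from it, would cross the curtain from `O` to that top vertex), so it lies in a class summable at every `y`; the part from
`s` on is a horizontal bridge whose span is determined by `ξ_min`, the exit row and `L`; for each head there are `T` possible exit rows,
each contributing at most the span-pointwise constant.  Left exits are mirror images of right exits.  NOT claimed: the limit of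
`E_{T,L}(x_c; y_T)` as `L → ∞` (conjecturally positive), anything at `y > y_T`, uniformity in `T`.
-/

noncomputable section

open Finset Filter Topology Matrix Literature.Probability.LatticeModels Literature.Probability.Percolation Literature.Analysis.Matrix

namespace Literature.Probability.RandomPlanarGeometry.SAW.HV

namespace EBnd

/-! ### §1 The outside staircase: `k` steps to the right from a type-0 vertex -/

/-- The rightward zig-zag of `k` steps starting at the type-`0` vertex `(x₀, x₁, false)`: `(x₀, x₁, f), (x₀, x₁, t), (x₀+1, x₁, f), …`
(the `i`-th vertex is `(x₀ + i/2, x₁, i odd)`, its column `ξ` is `2x₀ + x₁ + i`). [cite: DuminilCopinSmirnov2012, §3 (the hexagonal lattice in coordinates); lane plumbing] -/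
def stair (x₀ x₁ : ℤ) (k : ℕ) : List HV := (List.range (k + 1)).map fun i => (x₀ + (i / 2 : ℕ), x₁, decide (i % 2 = 1))

variable {x₀ x₁ : ℤ} {k : ℕ}

/-- Length of the staircase. [cite: DuminilCopinSmirnov2012, §3; lane plumbing] -/
@[simp] theorem length_stair (x₀ x₁ : ℤ) (k : ℕ) : (stair x₀ x₁ k).length = k + 1 := by simp [stair]

/-- The staircase is nonempty. [cite: DuminilCopinSmirnov2012, §3; lane plumbing] -/
theorem stair_ne_nil (x₀ x₁ : ℤ) (k : ℕ) : stair x₀ x₁ k ≠ [] := by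
  rw [← List.length_pos_iff_ne_nil, length_stair]; omega

/-- The `i`-th vertex of the staircase. [cite: DuminilCopinSmirnov2012, §3; lane plumbing] -/
theorem getElem_stair {i : ℕ} (hi : i < (stair x₀ x₁ k).length) :
    (stair x₀ x₁ k)[i] = (x₀ + (i / 2 : ℕ), x₁, decide (i % 2 = 1)) := by
  simp [stair, List.getElem_map, List.getElem_range]

/-- Columns along the staircase: `ξ = 2x₀ + x₁ + i`. [cite: DuminilCopinSmirnov2012, §3; lane plumbing] -/
theorem xi_getElem_stair {i : ℕ} (hi : i < (stair x₀ x₁ k).length) : xi ((stair x₀ x₁ k)[i]) = 2 * x₀ + x₁ + i := by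
  rw [getElem_stair hi, xi]
  rcases Nat.even_or_odd i with ⟨m, hm⟩ | ⟨m, hm⟩
  · subst hm
    have h1 : (m + m) / 2 = m := by omega
    have h2 : ¬ ((m + m) % 2 = 1) := by omega
    simp [h1, h2, bit]; ring
  · subst hm
    have h1 : (2 * m + 1) / 2 = m := by omega
    have h2 : (2 * m + 1) % 2 = 1 := by omega
    simp [h1, h2, bit]; ring

/-- Levels along the staircase: `2x₁` or `2x₁ + 1`. [cite: DuminilCopinSmirnov2012, §3; lane plumbing] -/
theorem lev_getElem_stair {i : ℕ} (hi : i < (stair x₀ x₁ k).length) :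
    lev ((stair x₀ x₁ k)[i]) = 2 * x₁ + (if i % 2 = 1 then 1 else 0) := by
  rw [getElem_stair hi]
  by_cases h : i % 2 = 1 <;> simp [h, bit]

/-- First coordinates along the staircase are `≥ x₀`. [cite: DuminilCopinSmirnov2012, §3; lane plumbing] -/
theorem le_fst_of_mem_stair {v : HV} (hv : v ∈ stair x₀ x₁ k) : x₀ ≤ v.1 := by
  obtain ⟨i, hi, rfl⟩ := List.mem_iff_getElem.1 hv
  rw [getElem_stair hi]; simp; positivity

/-- The staircase is a chain of `ℍ`. [cite: DuminilCopinSmirnov2012, §3; lane plumbing] -/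
theorem isChain_stair (x₀ x₁ : ℤ) (k : ℕ) : (stair x₀ x₁ k).IsChain hvGraph.Adj := by
  rw [List.isChain_iff_getElem]
  intro i hi
  rw [getElem_stair (by omega), getElem_stair hi, hvGraph_adj]
  rcases Nat.even_or_odd i with ⟨m, hm⟩ | ⟨m, hm⟩
  · subst hm
    have h1 : (m + m) / 2 = m := by omega
    have h2 : ¬ ((m + m) % 2 = 1) := by omega
    have h3 : (m + m + 1) / 2 = m := by omega
    have h4 : (m + m + 1) % 2 = 1 := by omega
    simp [h1, h2, h3, h4, AdjRel]
  · subst hm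
    have h1 : (2 * m + 1) / 2 = m := by omega
    have h2 : (2 * m + 1) % 2 = 1 := by omega
    have h3 : (2 * m + 1 + 1) / 2 = m + 1 := by omega
    have h4 : ¬ ((2 * m + 1 + 1) % 2 = 1) := by omega
    simp [h1, h2, h3, h4, AdjRel]; ring

/-- The staircase has no repeated vertex (its columns increase). [cite: DuminilCopinSmirnov2012, §3; lane plumbing] -/
theorem nodup_stair (x₀ x₁ : ℤ) (k : ℕ) : (stair x₀ x₁ k).Nodup := by
  rw [List.nodup_iff_injective_getElem]
  intro i j h
  have h1 := congrArg xi (show (stair x₀ x₁ k)[i.1] = (stair x₀ x₁ k)[j.1] from h)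
  rw [xi_getElem_stair i.2, xi_getElem_stair j.2] at h1
  exact Fin.ext (by exact_mod_cast (show (i.1 : ℤ) = j.1 by linarith))

/-- The head of the staircase. [cite: DuminilCopinSmirnov2012, §3; lane plumbing] -/
theorem head_stair (x₀ x₁ : ℤ) (k : ℕ) : (stair x₀ x₁ k).head (stair_ne_nil x₀ x₁ k) = (x₀, x₁, false) := by
  rw [← List.getElem_zero (by rw [length_stair]; omega), getElem_stair]; simp

/-! ### §2 Right-exit inner lists of `S_{T,L}` and their extension by the staircase -/

section Ext

variable {T L : ℕ}

/-- The exit vertex outside the right cut determined by the last inner vertex `(L, x₁, true)`: `(L+1, x₁, false)` (plumbing). [cite: DuminilCopinSmirnov2012, §3 (the cut ε of S_{T,L}); lane plumbing] -/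
def exitR (v : HV) : HV := (v.1 + 1, v.2.1, false)

/-- A walk `a → ε` of `S_{T,L}` leaving through the RIGHT cut is `w :: (l ⧺ [exitR (last l)])` with `l ≠ []`, `(last l).1 = L`,
`last l` of type `1`. [cite: DuminilCopinSmirnov2012, §3 (the cut ε of S_{T,L}); lane plumbing] -/
theorem eq_of_isEpsRight {P : List HV} (hP : IsMidWalk (stripV T L) P) (hε : IsEpsDart L (finalDart P)) (hx : (finalDart P).1.1 = (L : ℤ)) :
    ∃ (l : List HV) (hl : l ≠ []), P = wOut :: (l ++ [exitR (l.getLast hl)]) ∧ (l.getLast hl).1 = (L : ℤ) ∧ (l.getLast hl).2.2 = true := by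
  rcases hP.trivial_or_exists with rfl | ⟨l, u, hl, rfl⟩
  · exfalso
    rw [finalDart_trivial] at hε
    obtain ⟨-, ⟨-, h2⟩ | ⟨-, h2⟩⟩ := hε <;> simp [wOut, hvOrigin] at h2
  · rw [finalDart_cons_append hl] at hε hx
    obtain ⟨hb, ⟨h1, -⟩ | ⟨-, h2⟩⟩ := hε
    · exfalso
      dsimp only at h1 hx
      have hmem : l.getLast hl ∈ inner (wOut :: (l ++ [u])) := by rw [inner_cons_append]; exact List.getLast_mem hl
      have := (mem_stripV_iff.1 (hP.2.2.2.1 _ hmem)).1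
      omega
    · refine ⟨l, hl, ?_, hx, hb⟩
      dsimp only at h2
      rw [h2]; rfl

/-- The inner lists of the walks `a → ε` of `S_{T,L}` that leave through the RIGHT cut: self-avoiding chains from `O` in `S_{T,L}` whose last
vertex is `(L, x₁, true)`. [cite: DuminilCopinSmirnov2012, §3 (the boundary parts ε, ε̄ of S_{T,L}); lane] -/
def epsRightLists (T L : ℕ) : Finset (List HV) :=
  ((midWalks (stripV T L)).filter fun P => IsEpsDart L (finalDart P) ∧ (finalDart P).1.1 = (L : ℤ)).image inner

variable {l : List HV}

/-- Members of `epsRightLists` are chains from `O` in `S_{T,L}` ending at a type-1 vertex of the column `x₀ = L`.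
[cite: DuminilCopinSmirnov2012, §3; lane plumbing] -/
theorem of_mem_epsRightLists (hl : l ∈ epsRightLists T L) :
    l.IsChain hvGraph.Adj ∧ l.head? = some hvOrigin ∧ l.Nodup ∧ (∀ x ∈ l, x ∈ stripV T L) ∧
      ∃ h : l ≠ [], (l.getLast h).1 = (L : ℤ) ∧ (l.getLast h).2.2 = true := by
  rw [epsRightLists, mem_image] at hl
  obtain ⟨P, hP, rfl⟩ := hl
  rw [mem_filter, mem_midWalks_iff] at hP
  obtain ⟨hP, hε, hx⟩ := hP
  obtain ⟨l, hl, rfl, hx', hb⟩ := eq_of_isEpsRight hP hε hx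
  rw [inner_cons_append]
  obtain ⟨hc, hh, -, hV, hnd, -⟩ := (isMidWalk_cons_append_iff _ hl _).1 hP
  exact ⟨hc, hh, hnd, hV, hl, hx', hb⟩

/-- A right-exit inner list has at most `|V(S_{T,L})|` vertices. [cite: DuminilCopinSmirnov2012, §3; lane plumbing] -/
theorem length_le_card_of_mem_epsRightLists (hl : l ∈ epsRightLists T L) : l.length ≤ (stripV T L).card := by
  rw [epsRightLists, mem_image] at hl
  obtain ⟨P, hP, rfl⟩ := hl
  rw [mem_filter, mem_midWalks_iff] at hP
  rw [hP.1.length_inner]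
  exact hP.1.mwLen_le_card

/-- The right-exit class is part of the `ε` class: `Σ_{epsRightLists} x_c^{|l|} y^{#top} ≤ E_{T,L}(x_c; y)` (`y ≥ 0`).
[cite: DuminilCopinSmirnov2012, §3; BeatonBousquetMelouDeGierDuminilCopinGuttmann2014, §3.3 (E_{T,L}(x_c; y)); lane] -/
theorem sum_epsRightLists_le_stripGFy {y : ℝ} (hy : 0 ≤ y) :
    ∑ l ∈ epsRightLists T L, hexCriticalFugacity ^ l.length * y ^ topCnt T l ≤ stripGFy T L (IsEpsDart L) y := by
  classical
  set F := (midWalks (stripV T L)).filter fun P => IsEpsDart L (finalDart P) ∧ (finalDart P).1.1 = (L : ℤ) with hF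
  have hinj : Set.InjOn inner (F : Set (List HV)) := by
    intro P hP P' hP' h
    rw [mem_coe, hF, mem_filter, mem_midWalks_iff] at hP hP'
    obtain ⟨l, hl, rfl, -, -⟩ := eq_of_isEpsRight hP.1 hP.2.1 hP.2.2
    obtain ⟨l', hl', rfl, -, -⟩ := eq_of_isEpsRight hP'.1 hP'.2.1 hP'.2.2
    simp only [inner_cons_append] at h
    subst h
    rfl
  rw [epsRightLists, ← hF, sum_image hinj, stripGFy]
  calc ∑ P ∈ F, hexCriticalFugacity ^ (inner P).length * y ^ topCnt T (inner P)
      = ∑ P ∈ F, hexCriticalFugacity ^ mwLen P * y ^ surfContacts T P := by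
        refine sum_congr rfl fun P hP => ?_
        rw [hF, mem_filter, mem_midWalks_iff] at hP
        rw [hP.1.length_inner]; rfl
    _ ≤ ∑ P ∈ (midWalks (stripV T L)).filter (fun P => IsEpsDart L (finalDart P)), hexCriticalFugacity ^ mwLen P * y ^ surfContacts T P :=
        sum_le_sum_of_subset_of_nonneg (fun P hP => by rw [hF, mem_filter] at hP; exact mem_filter.2 ⟨hP.1, hP.2.1⟩)
          fun P _ _ => mul_nonneg (pow_nonneg hexCriticalFugacity_pos_lt_one.1.le _) (pow_nonneg hy _)

end Ext

/-! ### §3 The extension by the staircase: chain, self-avoiding, in the levels of `S_T`, its last vertex the unique rightmost -/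

section ExtProps

variable {T L : ℕ} {l : List HV}

/-- The extension of a right-exit inner list by a staircase of `T` more steps outside the box, starting at the exit vertex:
`l ⧺ stair (L+1) x₁ T` where `(L, x₁, true)` is the last vertex of `l`. [cite: DuminilCopinSmirnov2012, §3; lane] -/
def extR (T : ℕ) (l : List HV) : List HV := l ++ stair ((l.getLast?.getD hvOrigin).1 + 1) ((l.getLast?.getD hvOrigin).2.1) T

/-- Length of the extension. [cite: DuminilCopinSmirnov2012, §3; lane plumbing] -/
@[simp] theorem length_extR (T : ℕ) (l : List HV) : (extR T l).length = l.length + (T + 1) := by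
  rw [extR, List.length_append, length_stair]

/-- Unpacked data of a right-exit list: the last vertex `(L, x₁, true)` with `0 ≤ x₁ ≤ T − 1`, the columns of the box `≤ 2L + T`.
[cite: DuminilCopinSmirnov2012, §3 (S_{T,L}); lane plumbing] -/
theorem epsRight_data (hl : l ∈ epsRightLists T L) :
    ∃ hne : l ≠ [], ∃ x₁ : ℤ, l.getLast hne = ((L : ℤ), x₁, true) ∧ 0 ≤ x₁ ∧ x₁ + 1 ≤ (T : ℤ) ∧
      extR T l = l ++ stair ((L : ℤ) + 1) x₁ T ∧ (∀ w ∈ l, xi w ≤ 2 * (L : ℤ) + T ∧ w.1 ≤ (L : ℤ)) := by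
  obtain ⟨hc, hh, hnd, hV, hne, hx, hb⟩ := of_mem_epsRightLists hl
  rcases hz : l.getLast hne with ⟨p, q, b⟩
  rw [hz] at hx hb
  simp only at hx hb
  subst hx; subst hb
  have hmem := hV _ (List.getLast_mem hne)
  rw [hz, mem_stripV_iff] at hmem
  simp [bit] at hmem
  refine ⟨hne, q, hz, by omega, by omega, ?_, fun w hw => ?_⟩
  · rw [extR, List.getLast?_eq_some_getLast hne, Option.getD_some, hz]
  · have h := hV w hw
    rw [mem_stripV_iff] at h
    obtain ⟨a, c, d⟩ := w
    cases d <;> simp [xi, bit] at h ⊢ <;> omega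

/-- The extension is a chain of `ℍ` (the exit vertex is adjacent to the last inner vertex). [cite: DuminilCopinSmirnov2012, §3; lane plumbing] -/
theorem isChain_extR (hl : l ∈ epsRightLists T L) : (extR T l).IsChain hvGraph.Adj := by
  obtain ⟨hc, -, -, -, -⟩ := of_mem_epsRightLists hl
  obtain ⟨hne, x₁, hz, -, -, hext, -⟩ := epsRight_data hl
  rw [hext]
  refine List.IsChain.append hc (isChain_stair _ _ _) fun x hx y hy => ?_
  rw [List.getLast?_eq_some_getLast hne, Option.mem_def, Option.some_inj] at hx
  rw [List.head?_eq_some_head (stair_ne_nil _ _ _), Option.mem_def, Option.some_inj, head_stair] at hy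
  subst hx; subst hy
  rw [hz]; simp [hvGraph_adj, AdjRel]

/-- The extension has no repeated vertex (the staircase lies outside the box, `x₀ ≥ L + 1`). [cite: DuminilCopinSmirnov2012, §3; lane plumbing] -/
theorem nodup_extR (hl : l ∈ epsRightLists T L) : (extR T l).Nodup := by
  obtain ⟨-, -, hnd, -, -⟩ := of_mem_epsRightLists hl
  obtain ⟨hne, x₁, -, -, -, hext, hbox⟩ := epsRight_data hl
  rw [hext]
  refine List.nodup_append'.2 ⟨hnd, nodup_stair _ _ _, fun w hw hw' => ?_⟩
  have h1 := (hbox w hw).2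
  have h2 := le_fst_of_mem_stair hw'
  omega

/-- Every vertex of the extension lies in the levels `0 … 2T − 1`. [cite: DuminilCopinSmirnov2012, §3; lane plumbing] -/
theorem inLev_extR (hl : l ∈ epsRightLists T L) : InLev T (extR T l) := by
  obtain ⟨-, -, -, hV, -⟩ := of_mem_epsRightLists hl
  obtain ⟨hne, x₁, -, hx0, hx1, hext, -⟩ := epsRight_data hl
  rw [hext]
  intro w hw
  rcases List.mem_append.1 hw with hw | hw
  · have := lev_mem_of_mem_stripV (hV w hw); exact ⟨this.1, by exact_mod_cast this.2⟩
  · obtain ⟨i, hi, rfl⟩ := List.mem_iff_getElem.1 hw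
    rw [lev_getElem_stair hi]
    split_ifs <;> omega

/-- Columns along the extension: the box part has `ξ ≤ 2L + T`, the staircase part `ξ = 2(L+1) + x₁ + i ≥ 2L + 2`, and the LAST vertex
has the strictly largest column `2L + 2 + x₁ + T`. [cite: DuminilCopinSmirnov2012, §3; lane plumbing] -/
theorem xiAt_extR (hl : l ∈ epsRightLists T L) :
    ∃ x₁ : ℤ, 0 ≤ x₁ ∧ x₁ + 1 ≤ (T : ℤ) ∧
      (∀ (i : ℕ) (hi : i < l.length), xiAt (extR T l) i = xi (l[i]) ∧ xi (l[i]) ≤ 2 * (L : ℤ) + T) ∧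
      (∀ i : ℕ, i ≤ T → xiAt (extR T l) (l.length + i) = 2 * (L : ℤ) + 2 + x₁ + i) := by
  obtain ⟨hne, x₁, hz, hx0, hx1, hext, hbox⟩ := epsRight_data hl
  refine ⟨x₁, hx0, hx1, fun i hi => ?_, fun i hi => ?_⟩
  · have h : (extR T l)[i]'(by rw [length_extR]; omega) = l[i] := by
      simp only [hext]; exact List.getElem_append_left hi
    rw [xiAt_eq_xi_getElem (by rw [length_extR]; omega), h]
    exact ⟨rfl, (hbox _ (List.getElem_mem hi)).1⟩
  · have hlt : l.length + i < (extR T l).length := by rw [length_extR]; omega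
    have h : (extR T l)[l.length + i]'hlt = (stair ((L : ℤ) + 1) x₁ T)[i]'(by rw [length_stair]; omega) := by
      simp only [hext]; rw [List.getElem_append_right (by omega)]; simp
    rw [xiAt_eq_xi_getElem hlt, h, xi_getElem_stair]
    ring

/-- The last index of the minimal column lies in the box part, the minimal column is `≤ 0`, and every later vertex has a strictly larger
column, at most the last one's. [cite: DuminilCopinHammond2013, §2.2 (bridges: the last visit to the minimal coordinate); lane] -/
theorem sIdx_extR (hl : l ∈ epsRightLists T L) :
    sIdx (extR T l) < l.length ∧ xiAt (extR T l) (sIdx (extR T l)) ≤ 0 ∧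
      (∀ (j : ℕ), j < (extR T l).length → sIdx (extR T l) < j → xiAt (extR T l) (sIdx (extR T l)) < xiAt (extR T l) j) ∧
      (∀ (j : ℕ), j < (extR T l).length → xiAt (extR T l) j ≤ xiAt (extR T l) ((extR T l).length - 1)) ∧
      (∀ (j : ℕ), j + 1 < (extR T l).length → xiAt (extR T l) j < xiAt (extR T l) ((extR T l).length - 1)) := by
  obtain ⟨hc, hh, -, -, hne, -⟩ := of_mem_epsRightLists hl
  have hene : extR T l ≠ [] := by rw [← List.length_pos_iff_ne_nil, length_extR]; omega
  obtain ⟨hs, hmin, -⟩ := sIdx_spec hene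
  obtain ⟨x₁, hx0, hx1, hbox, hst⟩ := xiAt_extR hl
  have hlen := length_extR T l
  have hl0 : 0 < l.length := List.length_pos_of_ne_nil hne
  -- the head `O` has column 0
  have h0 : xiAt (extR T l) 0 = 0 := by
    have := (hbox 0 hl0).1
    rw [this]
    have hhd : l.head hne = hvOrigin := by
      have h := List.head?_eq_some_head hne
      rw [hh] at h
      exact (Option.some_inj.1 h).symm
    have hh' : l[0]'hl0 = hvOrigin := by rw [List.getElem_zero]; exact hhd
    rw [hh', xi_hvOrigin]
  have hmin0 : xiAt (extR T l) (sIdx (extR T l)) ≤ 0 := h0 ▸ hmin 0 (by rw [hlen]; omega)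
  -- the last vertex
  have hlast : xiAt (extR T l) ((extR T l).length - 1) = 2 * (L : ℤ) + 2 + x₁ + T := by
    rw [hlen, show l.length + (T + 1) - 1 = l.length + T by omega]
    exact hst T le_rfl
  refine ⟨?_, hmin0, fun j hj hsj => xiAt_sIdx_lt hene hj hsj, fun j hj => ?_, fun j hj => ?_⟩
  · by_contra hge
    rw [not_lt] at hge
    obtain ⟨i, hi⟩ : ∃ i, sIdx (extR T l) = l.length + i := ⟨_, (Nat.add_sub_cancel' hge).symm⟩
    have hiT : i ≤ T := by rw [hlen] at hs; omega
    have := hst i hiT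
    rw [← hi] at this
    linarith
  · rw [hlast]
    by_cases hjl : j < l.length
    · have := (hbox j hjl).2; rw [(hbox j hjl).1]; linarith
    · obtain ⟨i, rfl⟩ : ∃ i, j = l.length + i := ⟨j - l.length, by omega⟩
      have hiT : i ≤ T := by rw [hlen] at hj; omega
      rw [hst i hiT]
      have hi' : (i : ℤ) ≤ T := by exact_mod_cast hiT
      linarith
  · rw [hlast]
    by_cases hjl : j < l.length
    · have := (hbox j hjl).2; rw [(hbox j hjl).1]; linarith
    · obtain ⟨i, rfl⟩ : ∃ i, j = l.length + i := ⟨j - l.length, by omega⟩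
      have hiT : i ≤ T := by rw [hlen] at hj; omega
      rw [hst i hiT]
      have hi' : (i : ℤ) + 1 ≤ T := by rw [hlen] at hj; exact_mod_cast (by omega : i + 1 ≤ T)
      linarith

end ExtProps

/-! ### §4 The decomposition of a right-exit list: a top-free head before the last visit to the minimal column, then ONE horizontal
bridge (extended by the staircase) whose span is forced by the head's last column and the exit row -/

section Decomp

variable {T L : ℕ} {l : List HV}

/-- The head piece: up to (and including) the last visit to the minimal column. [cite: DuminilCopinHammond2013, §2.2; lane] -/
def eH (T : ℕ) (l : List HV) : List HV := (extR T l).take (sIdx (extR T l) + 1)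

/-- The bridge piece: from the last visit to the minimal column to the end of the staircase, standardised. [cite: DuminilCopinHammond2013, §2.2; lane] -/
def eB (T : ℕ) (l : List HV) : List HV := xstd ((extR T l).drop (sIdx (extR T l)))

/-- Prefixes of the extension inside the box part are prefixes of `l`. [cite: DuminilCopinHammond2013, §2.2; lane plumbing] -/
theorem take_extR {n : ℕ} (hn : n ≤ l.length) : (extR T l).take n = l.take n := by
  rw [extR]; exact List.take_append_of_le_length hn

/-- Suffixes of the extension starting inside the box part. [cite: DuminilCopinHammond2013, §2.2; lane plumbing] -/
theorem drop_extR {n : ℕ} (hn : n ≤ l.length) :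
    (extR T l).drop n = l.drop n ++ stair ((l.getLast?.getD hvOrigin).1 + 1) ((l.getLast?.getD hvOrigin).2.1) T := by
  rw [extR]; exact List.drop_append_of_le_length hn

/-- Elements of the extension inside the box part are elements of `l`. [cite: DuminilCopinHammond2013, §2.2; lane plumbing] -/
theorem getElem_extR_left {i : ℕ} (hi : i < l.length) :
    (extR T l)[i]'(by rw [length_extR]; omega) = l[i] := by
  simp only [extR]; exact List.getElem_append_left hi

/-- The head piece is a prefix of the box part. [cite: DuminilCopinHammond2013, §2.2; lane plumbing] -/
theorem eH_eq_take (hl : l ∈ epsRightLists T L) : eH T l = l.take (sIdx (extR T l) + 1) := by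
  have := (sIdx_extR hl).1
  rw [eH, take_extR (by omega)]

/-- The first vertex of the extension is `O`. [cite: DuminilCopinSmirnov2012, §3; lane plumbing] -/
theorem getElem_extR_zero (hl : l ∈ epsRightLists T L) :
    (extR T l)[0]'(by rw [length_extR]; omega) = hvOrigin := by
  obtain ⟨-, hh, -, -, hne, -⟩ := of_mem_epsRightLists hl
  rw [getElem_extR_left (List.length_pos_of_ne_nil hne), List.getElem_zero]
  have h := List.head?_eq_some_head hne
  rw [hh] at h
  exact (Option.some_inj.1 h).symm

/-- ★ **The curtain argument for side exits**: before the last visit to the minimal column a right-exit walk has NO top vertex — else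
the later passage from the minimal column to the end of the staircase (beyond every column of the walk) would cross the curtain hung
from `O` (level `0`) to that top vertex. [cite: DuminilCopinSmirnov2012, §3 (the strip S_T); lane: the tree's `HV.curtain_lemma`] -/
theorem lev_ne_top_of_lt_sIdx_extR (hl : l ∈ epsRightLists T L) {i : ℕ} (hi : i < sIdx (extR T l)) :
    lev ((extR T l)[i]'(by have := (sIdx_extR hl).1; have := length_extR T l; omega)) ≠ 2 * (T : ℤ) - 1 := by
  intro htop
  obtain ⟨hs, -, -, hmax, -⟩ := sIdx_extR hl
  have hlen := length_extR T l
  have hene : extR T l ≠ [] := by rw [← List.length_pos_iff_ne_nil, hlen]; omega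
  obtain ⟨-, hmin, -⟩ := sIdx_spec hene
  have hKne : (extR T l).take (i + 1) ≠ [] := by rw [← List.length_pos_iff_ne_nil, List.length_take]; omega
  have hPne : (extR T l).drop (sIdx (extR T l)) ≠ [] := by rw [← List.length_pos_iff_ne_nil, List.length_drop]; omega
  have hKhead : ((extR T l).take (i + 1)).head hKne = (extR T l)[0]'(by omega) := by
    rw [← List.getElem_zero (by rw [List.length_take]; omega)]; simp [List.getElem_take]
  have hKlast : ((extR T l).take (i + 1)).getLast hKne = (extR T l)[i]'(by omega) := by
    rw [List.getLast_eq_getElem]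
    simp only [List.getElem_take, List.length_take]
    have e : min (i + 1) (extR T l).length - 1 = i := by omega
    simp only [e]
  have hPhead : ((extR T l).drop (sIdx (extR T l))).head hPne = (extR T l)[sIdx (extR T l)]'(by omega) := by
    rw [← List.getElem_zero (by rw [List.length_drop]; omega)]; simp [List.getElem_drop]
  have hPlast : ((extR T l).drop (sIdx (extR T l))).getLast hPne = (extR T l)[(extR T l).length - 1]'(by omega) := by
    rw [List.getLast_eq_getElem]; simp only [List.getElem_drop, List.length_drop]
    congr 1; omega
  refine curtain_lemma (T := T) ((isChain_extR hl).take _) hKne (by rw [hKhead, getElem_extR_zero hl]; rfl)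
    (by rw [hKlast]; exact htop) ((isChain_extR hl).drop _) hPne
    (fun p hp => inLev_extR hl p ((List.drop_sublist _ _).subset hp)) ?_ ?_ ?_
  · -- disjointness from `Nodup`
    intro p hp hpK
    exact (List.disjoint_take_drop (nodup_extR hl) (show i + 1 ≤ sIdx (extR T l) by omega)) hpK hp
  · -- the bridge piece starts at the minimal column
    intro k hk
    obtain ⟨j, hj, rfl⟩ := List.mem_iff_getElem.1 hk
    rw [hPhead]
    simp only [List.getElem_take]
    rw [List.length_take] at hj
    have h := hmin j (by omega)
    rw [xiAt_eq_xi_getElem (by omega), xiAt_eq_xi_getElem (by omega)] at h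
    exact h
  · -- and ends beyond every column
    intro k hk
    obtain ⟨j, hj, rfl⟩ := List.mem_iff_getElem.1 hk
    rw [hPlast]
    simp only [List.getElem_take]
    rw [List.length_take] at hj
    have h := hmax j (by omega)
    rw [xiAt_eq_xi_getElem (by omega), xiAt_eq_xi_getElem (by omega)] at h
    exact h

/-- The head piece: a chain of `S_T` from `O` with at most `|V(S_{T,L})|` vertices, top-free except possibly its last vertex.
[cite: DuminilCopinHammond2013, §2.2; BeatonBousquetMelouDeGierDuminilCopinGuttmann2014, §3.2; lane] -/
theorem eH_mem (hl : l ∈ epsRightLists T L) :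
    eH T l ∈ LinLow.chainsUpTo T ((stripV T L).card) ∧ topCnt T (eH T l).dropLast = 0 := by
  obtain ⟨hc, hh, hnd, hV, hne, -⟩ := of_mem_epsRightLists hl
  have hsl : sIdx (extR T l) < l.length := (sIdx_extR hl).1
  have hcard := length_le_card_of_mem_epsRightLists hl
  rw [eH_eq_take hl]
  refine ⟨LinLow.mem_chainsUpTo_of_mem (n := sIdx (extR T l)) ?_ (by omega), ?_⟩
  · rw [mem_stripChains_iff]
    refine ⟨hc.take _, hnd.sublist (List.take_sublist _ _), by rw [List.length_take]; omega,
      ⟨hvOrigin, by rw [List.head?_take, if_neg (by omega), hh], rfl⟩, fun w hw => ?_⟩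
    have := lev_mem_of_mem_stripV (hV w ((List.take_sublist _ _).subset hw))
    exact ⟨this.1, by exact_mod_cast this.2⟩
  · have hdl : (l.take (sIdx (extR T l) + 1)).dropLast = l.take (sIdx (extR T l)) := by
      rw [List.dropLast_eq_take, List.length_take, Nat.min_eq_left (by omega), Nat.add_sub_cancel, List.take_take,
        Nat.min_eq_left (Nat.le_succ _)]
    rw [hdl, topCnt, List.length_eq_zero_iff, List.filter_eq_nil_iff]
    intro v hv
    obtain ⟨i, hi, rfl⟩ := List.mem_iff_getElem.1 hv
    rw [List.length_take] at hi
    simp only [List.getElem_take, decide_eq_true_eq]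
    have h := lev_ne_top_of_lt_sIdx_extR hl (i := i) (by omega)
    rwa [getElem_extR_left (by omega)] at h

/-- The bridge piece is a standard horizontal bridge of `S_T` with at least two vertices and at most `|V(S_{T,L})| + T + 1` steps, and
its span is forced: `hsp (eB) = (2L + 2 + x₁ + T) − ξ(last vertex of the head)` where `(L, x₁, true)` is the exit vertex.
[cite: DuminilCopinHammond2013, §2.2 (bridges: ω₁(0) < ω₁(i) ≤ ω₁(n)); lane] -/
theorem eB_mem (hl : l ∈ epsRightLists T L) :
    ∃ x₁ : ℤ, 0 ≤ x₁ ∧ x₁ + 1 ≤ (T : ℤ) ∧ (∃ hne : l ≠ [], l.getLast hne = ((L : ℤ), x₁, true)) ∧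
      eB T l ∈ (hBridgesN T ((stripV T L).card + T + 1)).filter (fun b => 2 ≤ b.length ∧
        hsp b = (2 * (L : ℤ) + 2 + x₁ + T) - xiAt (extR T l) (sIdx (extR T l))) := by
  obtain ⟨hc, hh, hnd, hV, hne, -⟩ := of_mem_epsRightLists hl
  obtain ⟨hne', x₁, hz, hx0, hx1, hext, hbox⟩ := epsRight_data hl
  obtain ⟨hs, -, hlater, hmax, -⟩ := sIdx_extR hl
  obtain ⟨x₁', -, -, -, hst⟩ := xiAt_extR hl
  have hlen := length_extR T l
  have hcard := length_le_card_of_mem_epsRightLists hl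
  have hene : extR T l ≠ [] := by rw [← List.length_pos_iff_ne_nil, hlen]; omega
  -- identify x₁' = x₁ through the last vertex of the extension
  have hlastE : (extR T l)[(extR T l).length - 1]'(by omega) = ((L : ℤ) + 1 + ((T : ℕ) / 2 : ℕ), x₁, decide (T % 2 = 1)) := by
    have h : (extR T l)[l.length + T]'(by omega) = (stair ((L : ℤ) + 1) x₁ T)[T]'(by rw [length_stair]; omega) := by
      simp only [hext]; rw [List.getElem_append_right (by omega)]; simp
    have e : (extR T l).length - 1 = l.length + T := by omega
    simp only [e, h, getElem_stair]
  have hxiLast : xiAt (extR T l) ((extR T l).length - 1) = 2 * (L : ℤ) + 2 + x₁ + T := by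
    rw [xiAt_eq_xi_getElem (by omega), hlastE, xi]
    rcases Nat.even_or_odd T with ⟨m, hm⟩ | ⟨m, hm⟩
    · have h1 : T / 2 = m := by omega
      have h2 : ¬ (T % 2 = 1) := by omega
      simp [h1, h2, bit]; omega
    · have h1 : T / 2 = m := by omega
      have h2 : T % 2 = 1 := by omega
      simp [h1, h2, bit]; omega
  refine ⟨x₁, hx0, hx1, ⟨hne', hz⟩, ?_⟩
  have hPne : (extR T l).drop (sIdx (extR T l)) ≠ [] := by rw [← List.length_pos_iff_ne_nil, List.length_drop]; omega
  have hPhead : ((extR T l).drop (sIdx (extR T l))).head hPne = (extR T l)[sIdx (extR T l)]'(by omega) := by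
    rw [← List.getElem_zero (by rw [List.length_drop]; omega)]; simp [List.getElem_drop]
  have hPlast : ((extR T l).drop (sIdx (extR T l))).getLast hPne = (extR T l)[(extR T l).length - 1]'(by omega) := by
    rw [List.getLast_eq_getElem]; simp only [List.getElem_drop, List.length_drop]
    congr 1; omega
  -- the piece is a horizontal bridge
  have hB : IsHBridge ((extR T l).drop (sIdx (extR T l))) := by
    refine ⟨hPne, fun v hv => ?_⟩
    rw [List.tail_drop] at hv
    obtain ⟨j, hj, rfl⟩ := List.mem_iff_getElem.1 hv
    rw [List.length_drop] at hj
    rw [hPhead, hPlast]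
    simp only [List.getElem_drop]
    have h1 := hlater (sIdx (extR T l) + 1 + j) (by omega) (by omega)
    have h2 := hmax (sIdx (extR T l) + 1 + j) (by omega)
    rw [xiAt_eq_xi_getElem (by omega), xiAt_eq_xi_getElem (by omega)] at h1
    rw [xiAt_eq_xi_getElem (by omega), xiAt_eq_xi_getElem (by omega)] at h2
    exact ⟨h1, h2⟩
  rw [mem_filter, eB, mem_hBridgesN_iff]
  refine ⟨⟨isChain_xstd ((isChain_extR hl).drop _), nodup_xstd ((nodup_extR hl).sublist (List.drop_sublist _ _)),
    by rw [length_xstd, List.length_drop]; omega, ⟨_, head?_xstd (List.head?_eq_some_head hPne), rfl⟩,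
    inLev_xstd fun w hw => inLev_extR hl w ((List.drop_sublist _ _).subset hw), isHBridge_xstd hB⟩,
    by rw [length_xstd, List.length_drop]; omega, ?_⟩
  rw [hsp_xstd, hsp, List.getLast?_eq_some_getLast hPne, List.head?_eq_some_head hPne, Option.getD_some, Option.getD_some, hPhead, hPlast,
    ← xiAt_eq_xi_getElem (by omega), ← xiAt_eq_xi_getElem (by omega), hxiLast]

/-- **Weights**: `x_c^{|l|} y^{#top(l)} ≤ x_c^{−(T+1)} · cwt(eH) · (x_c^{|eB|} y^{#top(eB)})` (`y ≥ 1`; the staircase costs `x_c^{T+1}` and only adds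
contacts). [cite: BeatonBousquetMelouDeGierDuminilCopinGuttmann2014, §3.2 (weights); lane] -/
theorem wt_le_eH_eB (hl : l ∈ epsRightLists T L) {y : ℝ} (hy : 1 ≤ y) :
    hexCriticalFugacity ^ l.length * y ^ topCnt T l ≤
      (hexCriticalFugacity ^ (T + 1))⁻¹ * (LinLow.cwt T y (eH T l) * (hexCriticalFugacity ^ (eB T l).length * y ^ topCnt T (eB T l))) := by
  have hx := hexCriticalFugacity_pos_lt_one.1
  obtain ⟨hs, -⟩ := sIdx_extR hl
  obtain ⟨hne', x₁, -, -, -, hext, -⟩ := epsRight_data hl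
  have hy0 : 0 ≤ y := by linarith
  obtain ⟨s, hs_eq⟩ : ∃ s, sIdx (extR T l) = s := ⟨_, rfl⟩
  rw [hs_eq] at hs
  have hH : LinLow.cwt T y (eH T l) = hexCriticalFugacity ^ s * y ^ topCnt T (l.take (s + 1)) := by
    rw [LinLow.cwt, eH_eq_take hl, hs_eq, List.length_take, Nat.min_eq_left (by omega), Nat.add_sub_cancel]
  have hBlen : (eB T l).length = l.length + (T + 1) - s := by rw [eB, length_xstd, List.length_drop, length_extR, hs_eq]
  have hBtop : topCnt T (l.drop s) ≤ topCnt T (eB T l) := by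
    rw [eB, topCnt_xstd, hs_eq, drop_extR (by omega), topCnt_append]
    omega
  have htop : topCnt T l ≤ topCnt T (l.take (s + 1)) + topCnt T (l.drop s) := by
    have e : topCnt T l = topCnt T (l.take s) + topCnt T (l.drop s) := by
      rw [← topCnt_append, List.take_append_drop]
    have h2 : topCnt T (l.take s) ≤ topCnt T (l.take (s + 1)) := by
      refine LinLow.topCnt_le_of_sublist T ?_
      rw [show l.take s = (l.take (s + 1)).take s by rw [List.take_take, Nat.min_eq_left (Nat.le_succ _)]]
      exact List.take_sublist _ _
    omega
  rw [hH, hBlen]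
  have e2 : (hexCriticalFugacity ^ (T + 1))⁻¹ * (hexCriticalFugacity ^ s * y ^ topCnt T (l.take (s + 1)) *
      (hexCriticalFugacity ^ (l.length + (T + 1) - s) * y ^ topCnt T (eB T l))) =
      hexCriticalFugacity ^ l.length * (y ^ topCnt T (l.take (s + 1)) * y ^ topCnt T (eB T l)) := by
    have e3 : hexCriticalFugacity ^ s * hexCriticalFugacity ^ (l.length + (T + 1) - s) = hexCriticalFugacity ^ l.length * hexCriticalFugacity ^ (T + 1) := by
      rw [← pow_add, ← pow_add]; congr 1; omega
    have hxT : hexCriticalFugacity ^ (T + 1) ≠ 0 := pow_ne_zero _ hx.ne'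
    field_simp
    nlinarith [e3]
  rw [e2, ← pow_add]
  exact mul_le_mul_of_nonneg_left (pow_le_pow_right₀ hy (htop.trans (by omega))) (pow_nonneg hx.le _)

/-- **The decomposition is injective** on the right-exit lists. [cite: DuminilCopinHammond2013, §2.2 (a walk is recovered from its pieces); lane] -/
theorem eH_eB_injOn (T L : ℕ) : Set.InjOn (fun l => (eH T l, eB T l)) (epsRightLists T L : Set (List HV)) := by
  intro l hl l' hl' h
  rw [mem_coe] at hl hl'
  simp only [Prod.mk.injEq] at h
  obtain ⟨hH, hB⟩ := h
  obtain ⟨hs, -⟩ := sIdx_extR hl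
  obtain ⟨hs', -⟩ := sIdx_extR hl'
  have hlen := length_extR T l
  have hlen' := length_extR T l'
  -- the split indices agree
  have es : sIdx (extR T l) = sIdx (extR T l') := by
    have := congrArg List.length hH
    rw [eH, eH, List.length_take, List.length_take] at this
    omega
  -- the vertex at the split agrees, hence the bridge pieces before standardisation
  have hne1 : (extR T l).drop (sIdx (extR T l)) ≠ [] := by rw [← List.length_pos_iff_ne_nil, List.length_drop]; omega
  have hne2 : (extR T l').drop (sIdx (extR T l')) ≠ [] := by rw [← List.length_pos_iff_ne_nil, List.length_drop]; omega
  have hv : (extR T l)[sIdx (extR T l)]'(by omega) = (extR T l')[sIdx (extR T l')]'(by omega) := by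
    have e : ((extR T l).take (sIdx (extR T l) + 1))[sIdx (extR T l)]? = ((extR T l').take (sIdx (extR T l') + 1))[sIdx (extR T l)]? := by
      rw [← eH, ← eH, hH]
    rw [List.getElem?_take_of_lt (by omega), List.getElem?_take_of_lt (by omega), List.getElem?_eq_getElem (by omega),
      List.getElem?_eq_getElem (by omega), Option.some_inj] at e
    rw [e]; simp only [es]
  have hdrop : (extR T l).drop (sIdx (extR T l)) = (extR T l').drop (sIdx (extR T l')) := by
    rw [eB, eB] at hB
    refine xstd_inj_of_head hB ?_
    rw [List.head?_drop, List.head?_drop, List.getElem?_eq_getElem (by omega), List.getElem?_eq_getElem (by omega), hv]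
  have htake : (extR T l).take (sIdx (extR T l)) = (extR T l').take (sIdx (extR T l')) := by
    have := congrArg (List.take (sIdx (extR T l))) hH
    rw [eH, eH, List.take_take, List.take_take, Nat.min_eq_left (Nat.le_succ _), es, Nat.min_eq_left (Nat.le_succ _)] at this
    rw [es]; exact this
  have hext : extR T l = extR T l' := by
    rw [← List.take_append_drop (sIdx (extR T l)) (extR T l), htake, hdrop, List.take_append_drop]
  have hll : l.length = l'.length := by have := congrArg List.length hext; rw [hlen, hlen'] at this; omega
  have h2 := hext
  rw [extR, extR] at h2
  exact List.append_inj_left h2 hll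

end Decomp

/-! ### §5 The right-exit class is bounded at the threshold -/

section SumRight

variable {T L : ℕ} {l : List HV}

/-- `Σ_{s ∪ t} f ≤ Σ_s f + Σ_t f` for `f ≥ 0` (plumbing). [cite: BeatonBousquetMelouDeGierDuminilCopinGuttmann2014, §3.2 (sums of non-negative weights); lane plumbing] (`private` — statement-twin of `HV.hvSum_union_le_add / HV.hvSum_biUnion_le_sum_sum` in `HexSAWStripThresholdPointwise.lean`, which this file does not import.) -/
private theorem sum_union_le_add {α : Type*} [DecidableEq α] (s t : Finset α) (f : α → ℝ) (hf : ∀ x, 0 ≤ f x) :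
    ∑ x ∈ s ∪ t, f x ≤ ∑ x ∈ s, f x + ∑ x ∈ t, f x := by
  rw [← Finset.sum_union_inter]
  have : 0 ≤ ∑ x ∈ s ∩ t, f x := sum_nonneg fun x _ => hf x
  linarith

/-- `Σ_{⋃_i t_i} f ≤ Σ_i Σ_{t_i} f` for `f ≥ 0` (plumbing). [cite: BeatonBousquetMelouDeGierDuminilCopinGuttmann2014, §3.2 (sums of non-negative weights); lane plumbing] (`private` — statement-twin of `HV.hvSum_union_le_add / HV.hvSum_biUnion_le_sum_sum` in `HexSAWStripThresholdPointwise.lean`, which this file does not import.) -/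
private theorem sum_biUnion_le_sum {ι α : Type*} [DecidableEq α] (s : Finset ι) (t : ι → Finset α) (f : α → ℝ)
    (hf : ∀ x, 0 ≤ f x) : ∑ x ∈ s.biUnion t, f x ≤ ∑ i ∈ s, ∑ x ∈ t i, f x := by
  classical
  induction s using Finset.induction_on with
  | empty => simp
  | insert a s ha ih =>
    rw [Finset.biUnion_insert, Finset.sum_insert ha]
    exact (sum_union_le_add _ _ f hf).trans (add_le_add le_rfl ih)

/-- The column of the last vertex of the head piece is the minimal column `ξ(ext[s])`. [cite: DuminilCopinHammond2013, §2.2; lane plumbing] -/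
theorem xi_getLast_eH (hl : l ∈ epsRightLists T L) :
    xi ((eH T l).getLast?.getD hvOrigin) = xiAt (extR T l) (sIdx (extR T l)) := by
  obtain ⟨hs, -⟩ := sIdx_extR hl
  have hlen := length_extR T l
  have hne : eH T l ≠ [] := by rw [eH, ← List.length_pos_iff_ne_nil, List.length_take]; omega
  rw [List.getLast?_eq_some_getLast hne, Option.getD_some, xiAt_eq_xi_getElem (by omega)]
  congr 1
  rw [List.getLast_eq_getElem]
  simp only [eH, List.getElem_take, List.length_take]
  have e : min (sIdx (extR T l) + 1) (extR T l).length - 1 = sIdx (extR T l) := by omega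
  simp only [e]

/-- The forced span, as a function of the head piece and the exit row (plumbing). [cite: DuminilCopinHammond2013, §2.2; lane plumbing] -/
def spanOf (T L : ℕ) (H : List HV) (r : ℕ) : ℤ := (2 * (L : ℤ) + 2 + r + T) - xi (H.getLast?.getD hvOrigin)

/-- A top-free-but-last head has at most one contact: `cwt(H) ≤ max(1,y) · x_c^{|H|−1}` (`y ≥ 0`).
[cite: BeatonBousquetMelouDeGierDuminilCopinGuttmann2014, §3.2; lane plumbing] -/
theorem cwt_le_of_topCnt_dropLast (y : ℝ) {H : List HV} (h0 : topCnt T H.dropLast = 0) :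
    LinLow.cwt T y H ≤ max 1 y * hexCriticalFugacity ^ (H.length - 1) := by
  have hx := hexCriticalFugacity_pos_lt_one.1
  have htop : topCnt T H ≤ 1 := by
    rcases eq_or_ne H [] with rfl | hne
    · simp [topCnt]
    · have e : H = H.dropLast ++ [H.getLast hne] := (List.dropLast_append_getLast hne).symm
      rw [e, topCnt_append, h0, topCnt_singleton]
      split_ifs <;> omega
  rw [LinLow.cwt, mul_comm]
  refine mul_le_mul_of_nonneg_right ?_ (pow_nonneg hx.le _)
  interval_cases h : topCnt T H
  · rw [pow_zero]; exact le_max_left _ _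
  · rw [pow_one]; exact le_max_right _ _

/-- ★★ **The right-exit class is bounded at the threshold**: there is `C = C(T)` with
`Σ_{l ∈ epsRightLists T L} x_c^{|l|} y_T^{#top(l)} ≤ C` for every `L` — head ⊕ one horizontal bridge of forced span, the head class
summable at `y_T` (at most one contact) and the span slices bounded (`HexSAWStripBridgeSpanPointwise`).
[cite: DuminilCopinSmirnov2012, §3 (E_{T,L}); DuminilCopinHammond2013, §2.2; lane «pcv-sawmu»: NEW] -/
theorem exists_sum_epsRightLists_le (hT : 1 ≤ T) :
    ∃ C : ℝ, ∀ L : ℕ, ∑ l ∈ epsRightLists T L, hexCriticalFugacity ^ l.length * stripYT T ^ topCnt T l ≤ C := by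
  classical
  have hx := hexCriticalFugacity_pos_lt_one.1
  have hy1 := one_le_stripYT hT
  have hy0 : 0 ≤ stripYT T := by linarith
  obtain ⟨S, hS0, hS⟩ := LinLow.exists_sum_pow_length_le hT
  obtain ⟨K, hK⟩ := exists_hBridgesN_span_stripYT_le hT
  have hK0 : 0 ≤ K := le_trans (sum_nonneg fun _ _ => mul_nonneg (pow_nonneg hx.le _) (pow_nonneg hy0 _)) (hK 0 0)
  set y := stripYT T with hydef
  refine ⟨(hexCriticalFugacity ^ (T + 1))⁻¹ * ((max 1 y * S) * ((T : ℝ) * K)), fun L => ?_⟩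
  set N₀ := (stripV T L).card with hN₀
  set N₁ := (stripV T L).card + T + 1 with hN₁
  set Heads := (LinLow.chainsUpTo T N₀).filter (fun H => topCnt T H.dropLast = 0) with hHeads
  set Br : ℤ → Finset (List HV) := fun σ => (hBridgesN T N₁).filter (fun b => 2 ≤ b.length ∧ hsp b = σ) with hBr
  set bw : List HV → ℝ := fun B => hexCriticalFugacity ^ B.length * y ^ topCnt T B with hbw
  set f : List HV × List HV → ℝ := fun q => LinLow.cwt T y q.1 * bw q.2 with hf
  have hf0 : ∀ q, 0 ≤ f q := fun q => mul_nonneg (LinLow.cwt_nonneg T hy0 _) (mul_nonneg (pow_nonneg hx.le _) (pow_nonneg hy0 _))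
  set tgt : Finset (List HV × List HV) :=
    Heads.biUnion (fun H => (range T).biUnion (fun r => ({H} : Finset (List HV)) ×ˢ Br (spanOf T L H r))) with htgt
  -- (1) termwise: weight ≤ x_c^{-(T+1)} f(eH, eB)
  have h1 : ∑ l ∈ epsRightLists T L, hexCriticalFugacity ^ l.length * y ^ topCnt T l ≤
      (hexCriticalFugacity ^ (T + 1))⁻¹ * ∑ l ∈ epsRightLists T L, f (eH T l, eB T l) := by
    rw [mul_sum]
    exact sum_le_sum fun l hl => wt_le_eH_eB hl hy1
  -- (2) the image lies in `tgt`
  have himg : ∀ l ∈ epsRightLists T L, (eH T l, eB T l) ∈ tgt := by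
    intro l hl
    obtain ⟨hHmem, hH0⟩ := eH_mem hl
    obtain ⟨x₁, hx0, hx1, -, hB⟩ := eB_mem hl
    rw [htgt, mem_biUnion]
    refine ⟨eH T l, mem_filter.2 ⟨hHmem, hH0⟩, ?_⟩
    rw [mem_biUnion]
    refine ⟨x₁.toNat, mem_range.2 (by omega), mem_product.2 ⟨mem_singleton_self _, ?_⟩⟩
    have e : spanOf T L (eH T l) x₁.toNat = (2 * (L : ℤ) + 2 + x₁ + T) - xiAt (extR T l) (sIdx (extR T l)) := by
      rw [spanOf, xi_getLast_eH hl, Int.toNat_of_nonneg hx0]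
    show eB T l ∈ Br (spanOf T L (eH T l) x₁.toNat)
    rw [hBr]; dsimp only; rw [e]; exact hB
  have h2 : ∑ l ∈ epsRightLists T L, f (eH T l, eB T l) ≤ ∑ q ∈ tgt, f q :=
    sum_le_sum_of_injOn_of_nonneg (fun l => (eH T l, eB T l)) (eH_eB_injOn T L) himg f fun q _ => hf0 q
  -- (3) summing over the target
  have h3 : ∑ q ∈ tgt, f q ≤ (max 1 y * S) * ((T : ℝ) * K) := by
    calc ∑ q ∈ tgt, f q ≤ ∑ H ∈ Heads, ∑ q ∈ (range T).biUnion (fun r => ({H} : Finset (List HV)) ×ˢ Br (spanOf T L H r)), f q :=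
          sum_biUnion_le_sum _ _ f hf0
      _ ≤ ∑ H ∈ Heads, ∑ r ∈ range T, ∑ q ∈ ({H} : Finset (List HV)) ×ˢ Br (spanOf T L H r), f q :=
          sum_le_sum fun H _ => sum_biUnion_le_sum _ _ f hf0
      _ = ∑ H ∈ Heads, ∑ r ∈ range T, LinLow.cwt T y H * ∑ B ∈ Br (spanOf T L H r), bw B := by
          refine sum_congr rfl fun H _ => sum_congr rfl fun r _ => ?_
          rw [sum_product, sum_singleton, mul_sum]
      _ ≤ ∑ H ∈ Heads, ∑ r ∈ range T, LinLow.cwt T y H * K := by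
          refine sum_le_sum fun H _ => sum_le_sum fun r _ => mul_le_mul_of_nonneg_left ?_ (LinLow.cwt_nonneg T hy0 _)
          exact hK N₁ _
      _ = (∑ H ∈ Heads, LinLow.cwt T y H) * ((T : ℝ) * K) := by
          rw [sum_mul]; refine sum_congr rfl fun H _ => ?_; rw [sum_const, card_range, nsmul_eq_mul]; ring
      _ ≤ (max 1 y * S) * ((T : ℝ) * K) := by
          refine mul_le_mul_of_nonneg_right ?_ (by positivity)
          calc ∑ H ∈ Heads, LinLow.cwt T y H ≤ ∑ H ∈ Heads, max 1 y * hexCriticalFugacity ^ (H.length - 1) :=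
                sum_le_sum fun H hH => cwt_le_of_topCnt_dropLast y (mem_filter.1 hH).2
            _ ≤ ∑ H ∈ LinLow.chainsUpTo T N₀, max 1 y * hexCriticalFugacity ^ (H.length - 1) :=
                sum_le_sum_of_subset_of_nonneg (filter_subset _ _) fun H _ _ => by positivity
            _ = max 1 y * ∑ H ∈ LinLow.chainsUpTo T N₀, hexCriticalFugacity ^ (H.length - 1) := by rw [mul_sum]
            _ ≤ max 1 y * S := mul_le_mul_of_nonneg_left (hS N₀) (by positivity)
  calc ∑ l ∈ epsRightLists T L, hexCriticalFugacity ^ l.length * y ^ topCnt T l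
      ≤ (hexCriticalFugacity ^ (T + 1))⁻¹ * ∑ l ∈ epsRightLists T L, f (eH T l, eB T l) := h1
    _ ≤ (hexCriticalFugacity ^ (T + 1))⁻¹ * ((max 1 y * S) * ((T : ℝ) * K)) :=
        mul_le_mul_of_nonneg_left (h2.trans h3) (inv_nonneg.2 (pow_nonneg hx.le _))

end SumRight

/-! ### §6 Left exits by the mirror, and the bound on `E_{T,L}(x_c; y_T)` -/

section Mirror

variable {T L : ℕ} {l : List HV}

/-- The converse membership: a self-avoiding chain from `O` in `S_{T,L}` ending at a type-1 vertex of the column `x₀ = L` is the inner list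
of a walk `a → ε` through the right cut. [cite: DuminilCopinSmirnov2012, §3 (the cut ε); lane plumbing] -/
theorem mem_epsRightLists_of (hc : l.IsChain hvGraph.Adj) (hh : l.head? = some hvOrigin) (hnd : l.Nodup) (hV : ∀ x ∈ l, x ∈ stripV T L)
    (hl : l ≠ []) (hx : (l.getLast hl).1 = (L : ℤ)) (hb : (l.getLast hl).2.2 = true) : l ∈ epsRightLists T L := by
  have hadj : hvGraph.Adj (l.getLast hl) (exitR (l.getLast hl)) := by
    rcases hz : l.getLast hl with ⟨p, q, b⟩
    rw [hz] at hb
    simp only at hb; subst hb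
    simp [exitR, hvGraph_adj, AdjRel]
  have huV : exitR (l.getLast hl) ∉ stripV T L := by
    rw [mem_stripV_iff]; simp [exitR, hx]
  refine mem_image.2 ⟨wOut :: (l ++ [exitR (l.getLast hl)]), ?_, inner_cons_append _ _⟩
  rw [mem_filter, mem_midWalks_iff, isMidWalk_cons_append_iff _ hl, finalDart_cons_append hl]
  refine ⟨⟨hc, hh, hadj, hV, hnd, ?_⟩, ⟨hb, Or.inr ⟨hx, by rw [exitR, hx]⟩⟩, hx⟩
  intro h
  rcases prevOf_mem l with h' | h'
  · have := h.trans h'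
    simp [exitR, wOut] at this
  · exact huV (h ▸ hV _ h')

/-- The exit vertex outside the LEFT cut determined by the last inner vertex `(−L−x₁−1, x₁, true)`: `(−L−x₁−1, x₁, false)` (plumbing).
[cite: DuminilCopinSmirnov2012, §3 (the cut ε̄); lane plumbing] -/
def exitL (v : HV) : HV := (v.1, v.2.1, false)

/-- A walk `a → ε̄` of `S_{T,L}` leaving through the LEFT cut is `w :: (l ⧺ [exitL (last l)])` with `l ≠ []`, `(last l).1 = −L − x₁ − 1`,
`last l` of type `1`. [cite: DuminilCopinSmirnov2012, §3 (the cut ε̄); lane plumbing] -/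
theorem eq_of_isEpsLeft {P : List HV} (hP : IsMidWalk (stripV T L) P) (hε : IsEpsDart L (finalDart P)) (hx : (finalDart P).1.1 ≠ (L : ℤ)) :
    ∃ (l : List HV) (hl : l ≠ []), P = wOut :: (l ++ [exitL (l.getLast hl)]) ∧
      (l.getLast hl).1 = -(L : ℤ) - (l.getLast hl).2.1 - 1 ∧ (l.getLast hl).2.2 = true := by
  rcases hP.trivial_or_exists with rfl | ⟨l, u, hl, rfl⟩
  · exfalso
    rw [finalDart_trivial] at hε
    obtain ⟨-, ⟨-, h2⟩ | ⟨-, h2⟩⟩ := hε <;> simp [wOut, hvOrigin] at h2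
  · rw [finalDart_cons_append hl] at hε hx
    obtain ⟨hb, ⟨h1, h2⟩ | ⟨h1, -⟩⟩ := hε
    · refine ⟨l, hl, ?_, h1, hb⟩
      dsimp only at h2
      rw [h2]; rfl
    · exact absurd h1 hx

/-- The inner lists of the walks `a → ε̄` (LEFT cut). [cite: DuminilCopinSmirnov2012, §3; lane] -/
def epsLeftLists (T L : ℕ) : Finset (List HV) :=
  ((midWalks (stripV T L)).filter fun P => IsEpsDart L (finalDart P) ∧ (finalDart P).1.1 ≠ (L : ℤ)).image inner

/-- Members of `epsLeftLists`. [cite: DuminilCopinSmirnov2012, §3; lane plumbing] -/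
theorem of_mem_epsLeftLists (hl : l ∈ epsLeftLists T L) :
    l.IsChain hvGraph.Adj ∧ l.head? = some hvOrigin ∧ l.Nodup ∧ (∀ x ∈ l, x ∈ stripV T L) ∧
      ∃ h : l ≠ [], (l.getLast h).1 = -(L : ℤ) - (l.getLast h).2.1 - 1 ∧ (l.getLast h).2.2 = true := by
  rw [epsLeftLists, mem_image] at hl
  obtain ⟨P, hP, rfl⟩ := hl
  rw [mem_filter, mem_midWalks_iff] at hP
  obtain ⟨hP, hε, hx⟩ := hP
  obtain ⟨l, hl, rfl, hx', hb⟩ := eq_of_isEpsLeft hP hε hx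
  rw [inner_cons_append]
  obtain ⟨hc, hh, -, hV, hnd, -⟩ := (isMidWalk_cons_append_iff _ hl _).1 hP
  exact ⟨hc, hh, hnd, hV, hl, hx', hb⟩

/-- ★ The mirror maps left-exit lists to right-exit lists. [cite: DuminilCopinSmirnov2012, §3 (Fig. 3: S_{T,L} is symmetric); lane] -/
theorem map_mirrorX_mem_epsRightLists (hl : l ∈ epsLeftLists T L) : l.map mirrorX ∈ epsRightLists T L := by
  obtain ⟨hc, hh, hnd, hV, hne, hx, hb⟩ := of_mem_epsLeftLists hl
  have hne' : l.map mirrorX ≠ [] := by simpa using hne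
  refine mem_epsRightLists_of ?_ ?_ (hnd.map (RelIso.injective _)) ?_ hne' ?_ ?_
  · rw [List.isChain_map]; exact hc.imp fun a b h => mirrorX.map_rel_iff.2 h
  · rw [List.head?_map, hh, Option.map_some, mirrorX_hvOrigin]
  · intro x hx'
    rw [List.mem_map] at hx'
    obtain ⟨w, hw, rfl⟩ := hx'
    exact mirrorX_mem_stripV (hV w hw)
  · rw [List.getLast_map, mirrorX_apply]
    rcases hz : l.getLast hne with ⟨p, q, b⟩
    rw [hz] at hx hb
    simp only at hx hb ⊢; subst hb
    simp [bit]; omega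
  · rw [List.getLast_map, mirrorX_apply]
    exact hb

/-- The mirror keeps lengths and top counts: weights are preserved. [cite: DuminilCopinSmirnov2012, §3; lane plumbing] -/
theorem wt_map_mirrorX (y : ℝ) (l : List HV) :
    hexCriticalFugacity ^ (l.map mirrorX).length * y ^ topCnt T (l.map mirrorX) = hexCriticalFugacity ^ l.length * y ^ topCnt T l := by
  rw [List.length_map, topCnt_map_mirrorX]

/-- The `ε` class splits into right and left exits: `E_{T,L}(x_c; y) = Σ_{epsRightLists} + Σ_{epsLeftLists}` of `x_c^{|l|} y^{#top(l)}`.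
[cite: DuminilCopinSmirnov2012, §3 (ε and ε̄); BeatonBousquetMelouDeGierDuminilCopinGuttmann2014, §3.3; lane] -/
theorem stripGFy_eps_eq_sum_right_add_left (y : ℝ) :
    stripGFy T L (IsEpsDart L) y = (∑ l ∈ epsRightLists T L, hexCriticalFugacity ^ l.length * y ^ topCnt T l) +
      ∑ l ∈ epsLeftLists T L, hexCriticalFugacity ^ l.length * y ^ topCnt T l := by
  classical
  set w : List HV → ℝ := fun P => hexCriticalFugacity ^ mwLen P * y ^ surfContacts T P with hw
  set FR := (midWalks (stripV T L)).filter (fun P => IsEpsDart L (finalDart P) ∧ (finalDart P).1.1 = (L : ℤ)) with hFR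
  set FL := (midWalks (stripV T L)).filter (fun P => IsEpsDart L (finalDart P) ∧ (finalDart P).1.1 ≠ (L : ℤ)) with hFL
  -- the ε class is the disjoint union of the right and left exits
  have hsplit : stripGFy T L (IsEpsDart L) y = ∑ P ∈ FR, w P + ∑ P ∈ FL, w P := by
    rw [stripGFy, ← sum_filter_add_sum_filter_not ((midWalks (stripV T L)).filter fun P => IsEpsDart L (finalDart P))
      (fun P => (finalDart P).1.1 = (L : ℤ)), filter_filter, filter_filter]
  have hR : ∑ P ∈ FR, w P = ∑ l ∈ epsRightLists T L, hexCriticalFugacity ^ l.length * y ^ topCnt T l := by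
    rw [epsRightLists, sum_image]
    · refine sum_congr rfl fun P hP => ?_
      rw [mem_filter, mem_midWalks_iff] at hP
      rw [hw]; dsimp only; rw [hP.1.length_inner]; rfl
    · intro P hP P' hP' h
      rw [mem_coe, mem_filter, mem_midWalks_iff] at hP hP'
      obtain ⟨l, hl, rfl, -, -⟩ := eq_of_isEpsRight hP.1 hP.2.1 hP.2.2
      obtain ⟨l', hl', rfl, -, -⟩ := eq_of_isEpsRight hP'.1 hP'.2.1 hP'.2.2
      simp only [inner_cons_append] at h
      subst h; rfl
  have hLsum : ∑ P ∈ FL, w P = ∑ l ∈ epsLeftLists T L, hexCriticalFugacity ^ l.length * y ^ topCnt T l := by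
    rw [epsLeftLists, sum_image]
    · refine sum_congr rfl fun P hP => ?_
      rw [mem_filter, mem_midWalks_iff] at hP
      rw [hw]; dsimp only; rw [hP.1.length_inner]; rfl
    · intro P hP P' hP' h
      rw [mem_coe, mem_filter, mem_midWalks_iff] at hP hP'
      obtain ⟨l, hl, rfl, -, -⟩ := eq_of_isEpsLeft hP.1 hP.2.1 hP.2.2
      obtain ⟨l', hl', rfl, -, -⟩ := eq_of_isEpsLeft hP'.1 hP'.2.1 hP'.2.2
      simp only [inner_cons_append] at h
      subst h; rfl
  rw [hsplit, hR, hLsum]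

/-- The left-exit sum is at most the right-exit sum (`y ≥ 0`), by the mirror. [cite: DuminilCopinSmirnov2012, §3 (symmetry of S_{T,L}); lane] -/
theorem sum_left_le_sum_right {y : ℝ} (hy : 0 ≤ y) :
    ∑ l ∈ epsLeftLists T L, hexCriticalFugacity ^ l.length * y ^ topCnt T l ≤
      ∑ l ∈ epsRightLists T L, hexCriticalFugacity ^ l.length * y ^ topCnt T l := by
  calc ∑ l ∈ epsLeftLists T L, hexCriticalFugacity ^ l.length * y ^ topCnt T l
      = ∑ l ∈ epsLeftLists T L, hexCriticalFugacity ^ (l.map mirrorX).length * y ^ topCnt T (l.map mirrorX) :=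
        sum_congr rfl fun l _ => (wt_map_mirrorX y l).symm
    _ ≤ ∑ l ∈ epsRightLists T L, hexCriticalFugacity ^ l.length * y ^ topCnt T l :=
    by
        classical
        have hinj : Set.InjOn (fun l : List HV => l.map mirrorX) (epsLeftLists T L : Set (List HV)) :=
          fun l _ l' _ h => (List.map_injective_iff.2 (RelIso.injective mirrorX)) h
        exact sum_le_sum_of_injOn_of_nonneg (fun l : List HV => l.map mirrorX) hinj
          (fun l hl => map_mirrorX_mem_epsRightLists hl)
          (fun l : List HV => hexCriticalFugacity ^ l.length * y ^ topCnt T l)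
          fun l _ => mul_nonneg (pow_nonneg hexCriticalFugacity_pos_lt_one.1.le _) (pow_nonneg hy _)

end Mirror

end EBnd

/-! ### §7 ★★★ The side class is bounded at the threshold, and the lock-step of `A_{T,L}` and `B_{T,L}` -/

open EBnd

variable {T : ℕ}

/-- ★★★ **`E_{T,L}(x_c; y_T) ≤ C_T` for every `L`** (`T ≥ 1`): at the threshold NO mass escapes through the far sides of the box —
a walk to a side cut is a top-free head (finite class) followed by ONE horizontal bridge whose span is forced by the box, and the bridges
of each exact span are uniformly bounded at `y_T`.  (For `y < y_T` the tree has `E_{T,L}(x_c; y) → 0`; AT `y_T` boundedness is the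
statement.) [cite: DuminilCopinSmirnov2012, §3 (E_{T,L}); BeatonBousquetMelouDeGierDuminilCopinGuttmann2014, §3.3 and Corollary 8 (y_T); lane «pcv-sawmu»: NEW] -/
theorem exists_stripGFy_eps_stripYT_le (hT : 1 ≤ T) :
    ∃ C : ℝ, ∀ L : ℕ, stripGFy T L (IsEpsDart L) (stripYT T) ≤ C := by
  obtain ⟨C, hC⟩ := exists_sum_epsRightLists_le hT
  refine ⟨C + C, fun L => ?_⟩
  rw [stripGFy_eps_eq_sum_right_add_left]
  exact add_le_add (hC L) ((sum_left_le_sum_right (stripYT_pos hT).le).trans (hC L))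

/-- ★★★ **LOCK-STEP of the arches and the bridges at the threshold**: there is `C = C(T)` with
`|cos(3π/8) · A_{T,L}(x_c; y_T) + β(y_T) · B_{T,L}(x_c; y_T) − 1| ≤ C` for every `L` (`T ≥ 1`; `β(y_T) < 0`): the two divergent classes
(`≍ L` each) differ, in the exact proportion `−β(y_T)/cos(3π/8)`, by a BOUNDED amount — identity (16) at `y_T` with `E_{T,L}` bounded.
(The tree's `HV.tendsto_div_stripGFy_beta_stripYT` is the ratio statement; this is the difference statement.)
[cite: BeatonBousquetMelouDeGierDuminilCopinGuttmann2014, §4.1 eq. (16) (arXiv v5 p. 13) and Corollary 8 (p. 12); lane «pcv-sawmu»: NEW] -/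
theorem exists_abs_alpha_add_betaY_mul_beta_sub_one_le (hT : 1 ≤ T) :
    ∃ C : ℝ, ∀ L : ℕ, |Real.cos (3 * Real.pi / 8) * stripGFy T L IsAlphaDart (stripYT T) +
      betaY (stripYT T) * stripGFy T L (IsBetaDart T) (stripYT T) - 1| ≤ C := by
  obtain ⟨C, hC⟩ := exists_stripGFy_eps_stripYT_le hT
  have hy := stripYT_pos hT
  have hcε := cos_pi_div_four_pos'
  refine ⟨Real.cos (Real.pi / 4) * C, fun L => ?_⟩
  have hid := stripIdentityY_holds T L (stripYT T) hT hy
  have hE0 : 0 ≤ stripGFy T L (IsEpsDart L) (stripYT T) := stripGFy_nonneg' T L _ hy.le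
  have hEC := hC L
  rw [abs_le]
  constructor <;> nlinarith

/-- The same as a two-sided linear relation: `A_{T,L}(x_c; y_T) = (−β(y_T)/cos(3π/8)) · B_{T,L}(x_c; y_T) + O(1)`.
[cite: BeatonBousquetMelouDeGierDuminilCopinGuttmann2014, §4.1 eq. (16) (arXiv v5 p. 13); lane «pcv-sawmu»] -/
theorem exists_abs_alpha_sub_ratio_mul_beta_le (hT : 1 ≤ T) :
    ∃ C : ℝ, ∀ L : ℕ, |stripGFy T L IsAlphaDart (stripYT T) -
      (-betaY (stripYT T) / Real.cos (3 * Real.pi / 8)) * stripGFy T L (IsBetaDart T) (stripYT T)| ≤ C := by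
  obtain ⟨C, hC⟩ := exists_abs_alpha_add_betaY_mul_beta_sub_one_le hT
  have hcα := cos_three_pi_div_eight_pos
  refine ⟨(C + 1) / Real.cos (3 * Real.pi / 8), fun L => ?_⟩
  have h := hC L
  rw [abs_le] at h
  obtain ⟨h1, h2⟩ := h
  set A := stripGFy T L IsAlphaDart (stripYT T)
  set B := stripGFy T L (IsBetaDart T) (stripYT T)
  set c := Real.cos (3 * Real.pi / 8)
  have e : A - (-betaY (stripYT T) / c) * B = (c * A + betaY (stripYT T) * B) / c := by
    field_simp; ring
  rw [e, abs_le, ← neg_div]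
  exact ⟨div_le_div_of_nonneg_right (by linarith) hcα.le, div_le_div_of_nonneg_right (by linarith) hcα.le⟩

end Literature.Probability.RandomPlanarGeometry.SAW.HV
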